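import Summits.QuantumFields.YangMills.Theorems.UnitScaleTiltProp8FlatCubeQContraction
import Summits.QuantumFields.YangMills.Theorems.BalabanUVNodesK0S5CollarCubeDomains
import Summits.QuantumFields.YangMills.Theorems.BalabanUVNodesN07CubeDomainsAdm22
import Summits.QuantumFields.YangMills.Theorems.OneCertifiedCubeFiniteSizeCriterionGrid
import Literature.MathematicalPhysics.QuantumFieldTheory.Balaban1983to89.Node00.DomainsOfSeq
import Literature.MathematicalPhysics.QuantumFieldTheory.Balaban1983to89.Node00.Record12BgRowAnalysis
import HarnessLib

/-!
# N07 [B11] Sect. F at the record — **THE COLLAR PROPERTY OF THE RECORD's REGION FAMILY `domainsOfSeq s.Ω`** (UNSHRUNK) from the record's one-cube-layer separation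
# `Sect2.SeqSeparated M₁ s`, for ANY `M₁ ≥ 1` and with no `Adm22` floor — companion of `…N07RecordDomainsAdm22` ((δ3)+(δ4) of dag-n07-e g20's OFFER (δ))

Cell `pub-ymgap` (HUMAN RULINGS D-0062 ∕ D-0088), width seat `pub-ymgap-dag-n07-w6` g0 (second wave on N07 = [B11] = [Balaban1985Variational]); lane owner dag-n07-e g20 (OFFER (δ),
PRIORITY ORDER 2026-08-28 08:16Z: the permanent half first).  `--kind proof --as helper`; count-neutral.  [B6] = [Balaban1984PropagatorsII], [6] = [Balaban1985RegularSpaces],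
[III] = [Balaban1988Convergent], [I] = [Balaban1987RG1].

WHY.  The multi-level flat-averaging dictionary ∕ (Q2) chain of the K0 road (k0-s1-w1 g5 `…K0Stub1FlatAveragingDictionaryLevels`, cell bus 2026-08-28 08:12Z: «the collar instance
the chain consumes = the collar FOR `domainsOfSeq s.Ω` (unshrunk)») reads the UST-shape COLLAR PROPERTY of a nested family `D`:
`∀ i e, D.LamBond (i+1) e → ∀ z, blockOf z ∈ {e₋, e₊} → z ∈ D.Om i` (`UnitScaleTiltProp8ChartLocality.collar_of_adm22`, which derives it from `Adm22 D R M` under the floor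
`2L ≤ R·M + 1`).  At the record the separation is ONE layer of `L^{n+1}M₁`-cubes ([6] (1.3)–(1.6) *«dist(Ω_n, Ωᶜ_{n−1}) ≥ LⁿξM₁»*; `Sect2.SeqSeparated M₁ s`), and the Stage-13
closures have `M₁ = M = 1` (`B14SeparationOfRecord` §6b) — so the `Adm22` route (`…N07RecordDomainsAdm22.adm22_domainsOfSeq_seqOfRecord`: `R·M₁ + 1 ≤ L·M₁`) cannot meet the floor
`2L ≤ R·M₁ + 1` there.  THIS FILE proves the collar DIRECTLY from the one-layer separation by a block argument, for every `M₁ ≥ 1`: the `(i+1)`-block under an end-point of an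
index bond of `Λ_{i+1}` is the deep end-point's block or ADJACENT to it, and adjacent `(i+1)`-blocks lie within one layer of `L^{i+1}M₁`-cubes (cube indices of suitable lifts
differ by at most one — floor division by `M₁` has steps `≤ 1`, `FiniteSizeCriterion.abs_ediv_sub_ediv_le_one` reused).

WHAT IS PROVED (sorry-free; no definition; axioms standard; generic `P : Params` in §1–§2).
* §1 ★★ `mem_enlT_of_distSite_iterBlockOf_le_one` — `dist_n(Bⁿx, Bⁿx′) ≤ 1`, `x ∈ Y` ⇒ `x′ ∈ Y^{∼1}` for the
  `LⁿM₁`-cubes (`Sect2.enlT P (Lⁿ·M₁) 1 Y`; no divisibility: a deck-shifted lift of `x′` realises the near lift of its block label).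
* §2 ★★★ `collar_domainsOfSeq_of_sep` — decreasing `Ω`, `Sect2.enlT P (side L M₁ (j+1)) 1 (Ω (j+1)) ⊆ Ω j` (`1 ≤ j < k`), `1 ≤ M₁` ⇒ the collar property of `domainsOfSeq Ω k hk`
  at every level (level `0` by `Ω₀ = T`).
* §3 ★★ `collar_domainsOfSeq_seqOfRecord` — the same for the (2.18) index of record `s : SeqOfRecord F ν M g K k` with `Sect2.SeqSeparated M₁ s` (`hnest` from `s.chain`).
HONEST SCOPE.  Torus-cube ∕ lattice bookkeeping over [B6] (2.1)–(2.3), [6] (1.3)–(1.6), [III] (2.1) as typed; nothing of [B11] ∕ [15] ∕ [6] analysis is asserted; `stub_prop8StepCoP13` ∕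
K0⁷ ∕ K1⁸ NOT closed; N07 NOT discharged; counts 28∕28 · 5∕27 UNMOVED; one finite 𝕋⁴ programme at fixed ε — R4 closes the conditional finite-𝕋⁴ rung `BalabanLadder.UV` only, never the
summit; nothing continuum ∕ ℝ⁴ ∕ OS ∕ mass gap ∕ Clay.  No `sorry`, no `def`, no `instance`, no `notation`.

References: [B6] T. Bałaban, CMP **96** (1984) 223–250, (2.1)–(2.3) p. 224; [6] CMP **99** (1985) 75–102, (1.3)–(1.6) p. 77; [III] CMP **119** (1988) 243–285, (2.1) p. 254, p. 256;
[B11] CMP **102** (1985) 277–309, (150) p. 301; [I] CMP **109** (1987) 249–301, (0.1)–(0.3) pp. 251–252, p. 257.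
-/

set_option autoImplicit false

noncomputable section

namespace Summit.QuantumFields.YangMills.BalabanUVNodes.N07RecordDomainsCollar

open Literature.MathematicalPhysics.QuantumFieldTheory.Balaban1983to89
open Literature.MathematicalPhysics.QuantumFieldTheory.Balaban1983to89.Node00
open B6SectADomainsV1 (Domains)
open B5Eq118OneStroke (iterBlockOf iterBlockOf_succ val_iterBlockOf)
open B5Prop12FieldsLattice (distSite)
open B5Eq117TorusCarriers (Mk)
open B15DeterminingSets (embIter)
open B15Eq112TorusCover (cover lift cover_lift cover_apply)
open B14DomainGeom (Pt cubeIdx IdxNear enl)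
open B14.Eq213MaximalDomains (side)
open Summit.QuantumFields.YangMills.Theorems.K0S5CollarCubeDomains (exists_coverAt_lift_near)
open Summit.QuantumFields.YangMills.Theorems.FlatCubeQContraction (distSite_endpoints_le_one)
open Summit.QuantumFields.YangMills.Theorems.FiniteSizeCriterion (abs_ediv_sub_ediv_le_one)

variable {P : Params}

/-! ## §1  Adjacent blocks lie within one cube layer -/

/-- ★★ **ADJACENT `n`-BLOCKS LIE WITHIN ONE LAYER OF `LⁿM₁`-CUBES**: if the `n`-blocks of `x` and `x′` are within sup circular distance `1` in `T^{(n)}` (`n ≤ m + K`, `1 ≤ M₁`) and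
`x ∈ Y`, then `x′ ∈ Y^{∼1}` for the `LⁿM₁`-cube partition (`Sect2.enlT P (Lⁿ·M₁) 1 Y`): a deck-shifted lift of `x′` whose `n`-block label is the near lift of `Bⁿ(x′)` relative to the
label of `Bⁿ(x)` has `LⁿM₁`-cube index within `1` of that of `lift x` (floor division by `M₁` has steps `≤ 1`).  No divisibility hypothesis. [cite: Balaban1987RG1, (0.1)–(0.3) pp.251–252, p.257; Balaban1988Convergent, (2.1) p.254] -/
theorem mem_enlT_of_distSite_iterBlockOf_le_one {n : ℕ} (hn : n ≤ P.m + P.K) {M₁ : ℕ} (hM₁ : 1 ≤ M₁) {Y : Set (Site P 0)} {x x' : Site P 0}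
    (hx : x ∈ Y) (hd : distSite (Mk P n) (iterBlockOf n x) (iterBlockOf n x') ≤ 1) :
    x' ∈ Sect2.enlT P (P.L ^ n * M₁) 1 Y := by
  -- the level-`n` near lift `ζ` of the block of `x′`, relative to the standard label of the block of `x`
  obtain ⟨ζ, hζcov, hζnear⟩ := exists_coverAt_lift_near (P := P) n (fun μ => (((iterBlockOf n x) μ).val : ℤ)) (iterBlockOf n x')
  rw [coverAt_valLift] at hζnear
  -- integers `t_μ` with `ζ_μ = label(Bⁿx′)_μ + S_n·t_μ`
  have hζ : ∀ μ, ∃ t : ℤ, ζ μ = (((iterBlockOf n x') μ).val : ℤ) + (P.sitesPerDir n : ℤ) * t := by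
    intro μ
    have h := congrFun hζcov μ
    rw [coverAt_apply] at h
    have h' : ((ζ μ : ℤ) : ZMod (P.sitesPerDir n)) = ((((iterBlockOf n x') μ).val : ℤ) : ZMod (P.sitesPerDir n)) := by
      rw [h, Int.cast_natCast, ZMod.natCast_zmod_val]
    obtain ⟨c, hc⟩ := (ZMod.intCast_eq_intCast_iff_dvd_sub _ _ _).1 h'
    exact ⟨-c, by rw [mul_neg]; linarith⟩
  choose t ht using hζ
  -- the deck-shifted lift of `x′`
  have hper : (P.sitesPerDir 0 : ℤ) = (P.L : ℤ) ^ n * (P.sitesPerDir n : ℤ) := by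
    have h := N07CubeDomainsAdm22.sitesPerDir_eq_pow_mul (P := P) (Nat.zero_le n) hn
    rw [Nat.sub_zero] at h
    exact_mod_cast h
  have hLn : (0 : ℤ) < (P.L : ℤ) ^ n := by have := P.L_pos; positivity
  have hX'cov : cover P (fun μ => ((x' μ).val : ℤ) + (P.sitesPerDir 0 : ℤ) * t μ) = x' := by
    funext μ
    simp [cover_apply]
  -- block labels of the two lifts
  have hX'blk : ∀ μ, (((x' μ).val : ℤ) + (P.sitesPerDir 0 : ℤ) * t μ) / (P.L : ℤ) ^ n = ζ μ := by
    intro μ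
    rw [hper, mul_assoc, Int.add_mul_ediv_left _ _ hLn.ne', ht μ, ← Nat.cast_pow, ← Int.natCast_div, val_iterBlockOf n hn x' μ]
  have hXblk : ∀ μ, lift P x μ / (P.L : ℤ) ^ n = (((iterBlockOf n x) μ).val : ℤ) := by
    intro μ
    show (((x μ).val : ℕ) : ℤ) / (P.L : ℤ) ^ n = _
    rw [← Nat.cast_pow, ← Int.natCast_div, val_iterBlockOf n hn x μ]
  -- the `LⁿM₁`-cube indices differ by at most one
  have hnear : IdxNear (P.L ^ n * M₁) 1 (fun μ => ((x' μ).val : ℤ) + (P.sitesPerDir 0 : ℤ) * t μ) (lift P x) := by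
    intro μ
    show |((((x' μ).val : ℤ) + (P.sitesPerDir 0 : ℤ) * t μ) / ((P.L ^ n * M₁ : ℕ) : ℤ)) - lift P x μ / ((P.L ^ n * M₁ : ℕ) : ℤ)| ≤ ((1 : ℕ) : ℤ)
    rw [Nat.cast_mul, Nat.cast_pow, ← Int.ediv_ediv_of_nonneg hLn.le, ← Int.ediv_ediv_of_nonneg hLn.le, hX'blk, hXblk, Nat.cast_one]
    have h1 : (((((iterBlockOf n x) μ).val : ℤ) - ζ μ).natAbs : ℝ) ≤ 1 := (hζnear μ).trans hd
    have h2 : (((((iterBlockOf n x) μ).val : ℤ) - ζ μ).natAbs : ℤ) ≤ 1 := by exact_mod_cast h1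
    rw [Int.natCast_natAbs, abs_le] at h2
    exact abs_ediv_sub_ediv_le_one (by exact_mod_cast hM₁) ⟨by linarith [h2.1, h2.2], by linarith [h2.1, h2.2]⟩
  exact ⟨_, ⟨lift P x, by rw [Set.mem_preimage, cover_lift]; exact hx, hnear⟩, hX'cov⟩

/-! ## §2  The collar property of `domainsOfSeq Ω k` -/

/-- ★★★ **THE COLLAR PROPERTY OF `domainsOfSeq Ω k` FROM ONE-CUBE-LAYER SEPARATION** (UST shape of `ChartLocality.collar_of_adm22`, for ANY `M₁ ≥ 1` and no `R`): for a decreasing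
sequence with one layer of `L^{i+1}M₁`-cubes around `Ω_{i+1}` inside `Ω_i` (`1 ≤ i < k`; `Sect2.SeqSeparated M₁` unfolded), both `i`-blocks under the end-points of every index bond
`e ∈ Λ_{i+1}` are filled by `Ω_i^{(i)}`: one end-point `w` has `B^{i+1}(w) ⊆ Ω_{i+1}`, the `(i+1)`-block of any `z` under an end-point is `w` or adjacent to it, so every fine point of
`Bⁱ(z)` lies within one `L^{i+1}M₁`-cube layer of `Ω_{i+1}`, hence in `Ω_i`. [cite: Balaban1984PropagatorsII, (2.1)-(2.3) p.224; Balaban1985RegularSpaces, (1.3)-(1.6) p.77; Balaban1988Convergent, (2.1) p.254, p.256] -/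
theorem collar_domainsOfSeq_of_sep {Ω : ℕ → Set (Site P 0)} {k : ℕ} (hk : k ≤ P.m + P.K) {M₁ : ℕ} (hM₁ : 1 ≤ M₁)
    (hnest : ∀ i : ℕ, 1 ≤ i → i < k → Ω (i + 1) ⊆ Ω i)
    (hsep : ∀ j : ℕ, 1 ≤ j → j < k → Sect2.enlT P (side P.L M₁ (j + 1)) 1 (Ω (j + 1)) ⊆ Ω j) :
    ∀ (i : ℕ) (e : PBond P (i + 1)), (domainsOfSeq Ω k hk).LamBond (i + 1) e →
      ∀ z : Site P i, (blockOf z = e.src ∨ blockOf z = e.tgt) → z ∈ (domainsOfSeq Ω k hk).Om i := by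
  intro i e he z hz
  have hik : i + 1 ≤ k := (domainsOfSeq Ω k hk).le_of_lamBond he
  have hiK : i + 1 ≤ P.m + P.K := hik.trans hk
  obtain ⟨hends, -, -⟩ := he
  -- level `0`: `Ω₀ = T`
  rcases Nat.eq_zero_or_pos i with rfl | hi1
  · rw [(domainsOfSeq Ω k hk).Om_zero]; exact Finset.mem_univ _
  -- an end-point `w` of `e` with `B^{i+1}(w) ⊆ Ω_{i+1}`
  have key : ∀ w : Site P (i + 1), w ∈ (domainsOfSeq Ω k hk).Om (i + 1) → (w = e.src ∨ w = e.tgt) → z ∈ (domainsOfSeq Ω k hk).Om i := by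
    intro w hw hwe
    rw [mem_domainsOfSeq_Om_iff_subset Ω hk hnest (by omega) hik] at hw
    rw [mem_domainsOfSeq_Om_iff_subset Ω hk hnest hi1 (by omega)]
    intro x' hx'
    -- the centre of `w` is in `Ω_{i+1}`; the `(i+1)`-block of `x′` is `blockOf z`, within distance `1` of `w`
    have hx : embIter (i + 1) w ∈ Ω (i + 1) := hw _ (iterBlockOf_embIter_eq hiK w)
    have hd : distSite (Mk P (i + 1)) (iterBlockOf (i + 1) (embIter (i + 1) w)) (iterBlockOf (i + 1) x') ≤ 1 := by
      rw [iterBlockOf_embIter_eq hiK w, iterBlockOf_succ, hx']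
      exact distSite_endpoints_le_one e hz hwe
    have hmem := mem_enlT_of_distSite_iterBlockOf_le_one hiK hM₁ hx hd
    exact hsep i hi1 (by omega) hmem
  rcases hends with h | h
  · exact key e.src h (Or.inl rfl)
  · exact key e.tgt h (Or.inr rfl)

/-! ## §3  At the (2.18) index of record -/

section RecordCollar

variable (F : T4Continuum.T4Family)

/-- ★★ **THE COLLAR PROPERTY OF THE RECORD's REGION FAMILY** `domainsOfSeq s.Ω k hk` for a print-separated (2.18) index `s` (`Sect2.SeqSeparated M₁ s`, any `1 ≤ M₁` — in
particular the record's `M₁ = 1` closures): the `hcollar` of the multi-level flat-averaging dictionary ∕ (Q2) chain (k0-s1-w1 g5) with NO `Adm22` floor. [cite: Balaban1984PropagatorsII, (2.1)-(2.3) p.224; Balaban1985RegularSpaces, (1.3)-(1.6) p.77] -/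
theorem collar_domainsOfSeq_seqOfRecord (ν : Stage7Numerics) (M : ℕ) (g : ℕ → ℝ) (K k : ℕ) (hk : k ≤ (F.P K).m + (F.P K).K)
    (s : SeqOfRecord F ν M g K k) {M₁ : ℕ} (hM₁ : 1 ≤ M₁) (hsep : Sect2.SeqSeparated M₁ s) :
    ∀ (i : ℕ) (e : PBond (F.P K) (i + 1)), (domainsOfSeq s.Ω k hk).LamBond (i + 1) e →
      ∀ z : Site (F.P K) i, (blockOf z = e.src ∨ blockOf z = e.tgt) → z ∈ (domainsOfSeq s.Ω k hk).Om i :=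
  collar_domainsOfSeq_of_sep hk hM₁ (fun _ h1 hi => s.chain.Ω_succ_subset_Ω h1 hi) hsep

end RecordCollar

end Summit.QuantumFields.YangMills.BalabanUVNodes.N07RecordDomainsCollar

end
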